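import Literature.MathematicalPhysics.KineticTheory.EvenStatTruncationBound
import Literature.MathematicalPhysics.KineticTheory.CollisionTubeWeightOscillation
import HarnessLib

/-!
# The time-mollified pool pair field of a hard-sphere orbit: bounds, Lipschitz continuity

Topic `Literature/MathematicalPhysics/KineticTheory` (proof item; wanted by the crux line `Sketch` of
`InformationPercolationEngine.PercolationClosesChaos`, stmt-AtomisticToContinuum-14915, helper stub
`stub_pullbackInProb`).  The route target `ContactChaos` weights its collision sums by the
TIME-MOLLIFIED `r`-POOL PAIR FIELD of the orbit,
`Pm(Θ Th)(z, s₀, x₀) = ∫_{[0,τ]} r⁻¹(1 − |s − s₀|/r)₊ · B_r(Th)(Φ_s z, x₀) ds`,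
`B_r(Th)(ζ, x₀) = ∫∫ b_r(y, x₀) b_r(y', x₀) Θ(Th)(v, v') dμ_ζ dμ_ζ` (`pairFunctional`, `b_r = coneKernel r`,
`Θ = sphereMark`).  For the collision-cylinder pull-back (CIP 1994 §2.2, App. 4.A) of such a weighted
collision sum one needs this weight, for a FIXED good initial datum `z`, to be a bounded continuous
function of `(s₀, x₀)` with an explicit modulus; this file provides it:

* `abs_sphereMark_le_of_abs_le`, `abs_sphereMark_le_quad_of_abs_le` — for a bounded mark
  `|Th| ≤ C`: `|Θ(Th)(v, w)| ≤ |S²| C ‖w − v‖ ≤ |S²| C (1 + (‖v‖² + ‖w‖²)/2)`;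
* `abs_pairFunctional_le_of_abs_le`, `abs_pairFunctional_sub_le_of_abs_le` — the pair functional is
  bounded by `(3/πr³)² |S²| C (1 + 2E/(N+1))` and `euclidDist`-Lipschitz in the anchor with constant
  `2 (3/πr⁴)(3/πr³) |S²| C (1 + 2E/(N+1))` (`E` the kinetic energy of the configuration; the cone kernel is
  `3/(πr⁴)`-Lipschitz, `abs_coneKernel_sub_coneKernel_le`);
* `continuous_pairFunctional_config` — continuity in the configuration (a finite double sum);
* `poolPairField` — the time-mollified field along a hard-sphere flow, and, on a good orbit with kinetic
  energy per particle `≤ E₀` (conserved, `HardSphereFlow.configEnergy_flow`):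
  `abs_poolPairField_le`, `abs_poolPairField_sub_le` (jointly Lipschitz in `(s₀, x₀)`: the tent is
  `r⁻²`-Lipschitz and `≤ r⁻¹`), `continuous_poolPairField`.

## References

* C. Cercignani, R. Illner, M. Pulvirenti, *The Mathematical Theory of Dilute Gases* (1994), §2.2,
  App. 4.A (the collision cylinder read with continuous weights). [CIPDiluteGases1994]
* H. Spohn, *Large Scale Dynamics of Interacting Particles* (1991), Part I Ch. 3 (mollified empirical
  fields of the hard-sphere system). [Spohn1991]
-/

noncomputable section

open MeasureTheory Set Filter Topology
open scoped ENNReal InnerProductSpace BigOperators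

namespace Literature.MathematicalPhysics.KineticTheory

open _root_.MeasureTheory Literature.Analysis.FluidPDE

/-! ### The sphere-integrated mark of a bounded mark -/

/-- For a bounded mark `|Th| ≤ C`: `|Θ(Th)(v, w)| ≤ |S²| · C ‖w − v‖` (`((w − v)·ω)₊ ≤ ‖w − v‖`).
[folklore] -/
theorem abs_sphereMark_le_of_abs_le {Th : V3 × V3 × V3 → ℝ} {C : ℝ} (hC : ∀ p, |Th p| ≤ C) (v w : V3) :
    |sphereMark Th v w| ≤ sphereMeasure.real (univ : Set (Metric.sphere (0 : V3) 1)) * (C * ‖w - v‖) := by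
  refine abs_sphereMark_le_of_forall_le fun ω => ?_
  have hk := hardSphereKernel_nonneg_le v w ω
  rw [abs_mul, abs_of_nonneg hk.1]
  have hC0 : 0 ≤ C := (abs_nonneg _).trans (hC ((ω : V3), v, w))
  exact mul_le_mul (hC ((ω : V3), v, w)) hk.2 hk.1 hC0

/-- Quadratic-growth form: `|Θ(Th)(v, w)| ≤ |S²| C + (|S²| C / 2)(‖v‖² + ‖w‖²)` for `|Th| ≤ C`
(`‖w − v‖ ≤ 1 + ‖w − v‖²/4 ≤ 1 + (‖v‖² + ‖w‖²)/2`). [folklore] -/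
theorem abs_sphereMark_le_quad_of_abs_le {Th : V3 × V3 × V3 → ℝ} {C : ℝ} (hC : ∀ p, |Th p| ≤ C)
    (v w : V3) :
    |sphereMark Th v w| ≤ sphereMeasure.real (univ : Set (Metric.sphere (0 : V3) 1)) * C +
      sphereMeasure.real (univ : Set (Metric.sphere (0 : V3) 1)) * C / 2 * (‖v‖ ^ 2 + ‖w‖ ^ 2) := by
  have hS0 : 0 ≤ sphereMeasure.real (univ : Set (Metric.sphere (0 : V3) 1)) := measureReal_nonneg
  have hC0 : 0 ≤ C := (abs_nonneg _).trans (hC (0, 0, 0))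
  have h1 := abs_sphereMark_le_of_abs_le hC v w
  have h2 : ‖w - v‖ ≤ 1 + (‖v‖ ^ 2 + ‖w‖ ^ 2) / 2 := by
    have h' : ‖w - v‖ ≤ ‖w‖ + ‖v‖ := norm_sub_le w v
    nlinarith [sq_nonneg (‖w‖ + ‖v‖ - 2), sq_nonneg (‖w‖ - ‖v‖), norm_nonneg w, norm_nonneg v]
  calc |sphereMark Th v w| ≤ sphereMeasure.real (univ : Set (Metric.sphere (0 : V3) 1)) * (C * ‖w - v‖) := h1
    _ ≤ sphereMeasure.real (univ : Set (Metric.sphere (0 : V3) 1)) * (C * (1 + (‖v‖ ^ 2 + ‖w‖ ^ 2) / 2)) := by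
        gcongr
    _ = _ := by ring

/-! ### The pair functional of a bounded mark: energy bound, Lipschitz in the anchor, continuity -/

/-- **Energy bound of the pair functional of a bounded mark**:
`|B_r(Th)(ζ, x)| ≤ (3/πr³)² |S²| C (1 + 2 E(ζ)/(N+1))`. [folklore] -/
theorem abs_pairFunctional_le_of_abs_le {N : ℕ} {Th : V3 × V3 × V3 → ℝ} {C : ℝ} (hC : ∀ p, |Th p| ≤ C)
    {r : ℝ} (hr : 0 < r) (ζ : Config (N + 1) (Fin 3) T3) (x : UnitAddTorus (Fin 3)) :
    |pairFunctional r Th ζ x| ≤ (3 / (Real.pi * r ^ 3)) ^ 2 *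
      (sphereMeasure.real (univ : Set (Metric.sphere (0 : V3) 1)) * C) *
        (1 + 2 * configEnergy ζ / ((N + 1 : ℕ) : ℝ)) := by
  have h := abs_pairFunctional_le_of_sphereMark_le (fun v w => abs_sphereMark_le_quad_of_abs_le hC v w) hr ζ x
  refine h.trans (le_of_eq ?_)
  ring

/-- `(N+1)⁻² Σᵢⱼ |Θ(Th)(vᵢ, vⱼ)| ≤ |S²| C (1 + 2E(ζ)/(N+1))` for a bounded mark. [folklore] -/
theorem sum_sum_abs_sphereMark_le_of_abs_le {N : ℕ} {Th : V3 × V3 × V3 → ℝ} {C : ℝ} (hC : ∀ p, |Th p| ≤ C)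
    (ζ : Config (N + 1) (Fin 3) T3) :
    ((N + 1 : ℕ) : ℝ)⁻¹ * ((N + 1 : ℕ) : ℝ)⁻¹ * ∑ i, ∑ j, |sphereMark Th (ζ i).2 (ζ j).2| ≤
      sphereMeasure.real (univ : Set (Metric.sphere (0 : V3) 1)) * C *
        (1 + 2 * configEnergy ζ / ((N + 1 : ℕ) : ℝ)) := by
  set S := sphereMeasure.real (univ : Set (Metric.sphere (0 : V3) 1)) with hS
  have hn : (0 : ℝ) < ((N + 1 : ℕ) : ℝ) := by exact_mod_cast Nat.succ_pos N
  have hterm : ∀ i j : Fin (N + 1), |(|sphereMark Th (ζ i).2 (ζ j).2|)| ≤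
      S * C + S * C / 2 * (‖(ζ i).2‖ ^ 2 + ‖(ζ j).2‖ ^ 2) := by
    intro i j
    rw [abs_abs]
    exact abs_sphereMark_le_quad_of_abs_le hC _ _
  have hsum := abs_sum_sum_le_of_le hterm
  rw [abs_of_nonneg (Finset.sum_nonneg fun i _ => Finset.sum_nonneg fun j _ => abs_nonneg _)] at hsum
  have hE : ∑ i : Fin (N + 1), ‖(ζ i).2‖ ^ 2 = 2 * configEnergy ζ := by
    unfold configEnergy; ring
  rw [hE] at hsum
  calc ((N + 1 : ℕ) : ℝ)⁻¹ * ((N + 1 : ℕ) : ℝ)⁻¹ * ∑ i, ∑ j, |sphereMark Th (ζ i).2 (ζ j).2|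
      ≤ ((N + 1 : ℕ) : ℝ)⁻¹ * ((N + 1 : ℕ) : ℝ)⁻¹ *
          ((((N + 1 : ℕ) : ℕ) : ℝ) ^ 2 * (S * C) + S * C / 2 * (2 * ((N + 1 : ℕ) : ℕ) * (2 * configEnergy ζ))) :=
        mul_le_mul_of_nonneg_left hsum (by positivity)
    _ = S * C * (1 + 2 * configEnergy ζ / ((N + 1 : ℕ) : ℝ)) := by
        push_cast
        field_simp

/-- **The pair functional of a bounded mark is Lipschitz in the anchor** (minimal-image distance):
`|B_r(Th)(ζ, x) − B_r(Th)(ζ, x')| ≤ 2 (3/πr⁴)(3/πr³) |S²| C (1 + 2E(ζ)/(N+1)) · d(x, x')`. [folklore] -/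
theorem abs_pairFunctional_sub_le_of_abs_le {N : ℕ} {Th : V3 × V3 × V3 → ℝ} {C : ℝ} (hC : ∀ p, |Th p| ≤ C)
    {r : ℝ} (hr : 0 < r) (ζ : Config (N + 1) (Fin 3) T3) (x x' : UnitAddTorus (Fin 3)) :
    |pairFunctional r Th ζ x - pairFunctional r Th ζ x'| ≤
      2 * (3 / (Real.pi * r ^ 4)) * (3 / (Real.pi * r ^ 3)) *
        (sphereMeasure.real (univ : Set (Metric.sphere (0 : V3) 1)) * C *
          (1 + 2 * configEnergy ζ / ((N + 1 : ℕ) : ℝ))) * Torus.euclidDist x x' := by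
  set M := 3 / (Real.pi * r ^ 3) with hM
  set Lk := 3 / (Real.pi * r ^ 4) with hLk
  set D := Torus.euclidDist x x' with hD
  have hM0 : 0 ≤ M := by positivity
  have hLk0 : 0 ≤ Lk := by positivity
  have hD0 : 0 ≤ D := by rw [hD, Torus.euclidDist_eq]; exact norm_nonneg _
  rw [pairFunctional_eq_double_sum, pairFunctional_eq_double_sum, ← mul_sub, ← Finset.sum_sub_distrib]
  simp_rw [← Finset.sum_sub_distrib]
  have hterm : ∀ i j : Fin (N + 1),
      |coneKernel r (ζ i).1 x * coneKernel r (ζ j).1 x * sphereMark Th (ζ i).2 (ζ j).2 -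
          coneKernel r (ζ i).1 x' * coneKernel r (ζ j).1 x' * sphereMark Th (ζ i).2 (ζ j).2| ≤
        2 * Lk * M * D * |sphereMark Th (ζ i).2 (ζ j).2| := by
    intro i j
    have hbi := coneKernel_nonneg hr (ζ i).1 x
    have hbi' := coneKernel_nonneg hr (ζ i).1 x'
    have hbj := coneKernel_nonneg hr (ζ j).1 x
    have hbjM := coneKernel_le hr (ζ j).1 x
    have hbi'M := coneKernel_le hr (ζ i).1 x'
    have hdi : |coneKernel r (ζ i).1 x - coneKernel r (ζ i).1 x'| ≤ Lk * D := by
      have h := abs_coneKernel_sub_coneKernel_le hr (ζ i).1 (ζ i).1 x x'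
      rwa [Torus.euclidDist_self, zero_add] at h
    have hdj : |coneKernel r (ζ j).1 x - coneKernel r (ζ j).1 x'| ≤ Lk * D := by
      have h := abs_coneKernel_sub_coneKernel_le hr (ζ j).1 (ζ j).1 x x'
      rwa [Torus.euclidDist_self, zero_add] at h
    have hsplit : coneKernel r (ζ i).1 x * coneKernel r (ζ j).1 x * sphereMark Th (ζ i).2 (ζ j).2 -
        coneKernel r (ζ i).1 x' * coneKernel r (ζ j).1 x' * sphereMark Th (ζ i).2 (ζ j).2 =
        ((coneKernel r (ζ i).1 x - coneKernel r (ζ i).1 x') * coneKernel r (ζ j).1 x +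
          coneKernel r (ζ i).1 x' * (coneKernel r (ζ j).1 x - coneKernel r (ζ j).1 x')) *
          sphereMark Th (ζ i).2 (ζ j).2 := by ring
    rw [hsplit, abs_mul]
    refine mul_le_mul_of_nonneg_right ?_ (abs_nonneg _)
    calc |(coneKernel r (ζ i).1 x - coneKernel r (ζ i).1 x') * coneKernel r (ζ j).1 x +
            coneKernel r (ζ i).1 x' * (coneKernel r (ζ j).1 x - coneKernel r (ζ j).1 x')|
        ≤ |coneKernel r (ζ i).1 x - coneKernel r (ζ i).1 x'| * coneKernel r (ζ j).1 x +
            coneKernel r (ζ i).1 x' * |coneKernel r (ζ j).1 x - coneKernel r (ζ j).1 x'| := by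
          refine (abs_add_le _ _).trans (le_of_eq ?_)
          rw [abs_mul, abs_mul, abs_of_nonneg hbj, abs_of_nonneg hbi']
      _ ≤ Lk * D * M + M * (Lk * D) :=
          add_le_add (mul_le_mul hdi hbjM hbj (mul_nonneg hLk0 hD0)) (mul_le_mul hbi'M hdj (abs_nonneg _) hM0)
      _ = 2 * Lk * M * D := by ring
  have hn0 : (0 : ℝ) ≤ ((N + 1 : ℕ) : ℝ)⁻¹ * ((N + 1 : ℕ) : ℝ)⁻¹ := by positivity
  rw [abs_mul, abs_of_nonneg hn0]
  calc ((N + 1 : ℕ) : ℝ)⁻¹ * ((N + 1 : ℕ) : ℝ)⁻¹ *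
        |∑ i, ∑ j, (coneKernel r (ζ i).1 x * coneKernel r (ζ j).1 x * sphereMark Th (ζ i).2 (ζ j).2 -
            coneKernel r (ζ i).1 x' * coneKernel r (ζ j).1 x' * sphereMark Th (ζ i).2 (ζ j).2)|
      ≤ ((N + 1 : ℕ) : ℝ)⁻¹ * ((N + 1 : ℕ) : ℝ)⁻¹ *
          ∑ i, ∑ j, 2 * Lk * M * D * |sphereMark Th (ζ i).2 (ζ j).2| := by
        refine mul_le_mul_of_nonneg_left ?_ hn0
        refine (Finset.abs_sum_le_sum_abs _ _).trans (Finset.sum_le_sum fun i _ => ?_)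
        exact (Finset.abs_sum_le_sum_abs _ _).trans (Finset.sum_le_sum fun j _ => hterm i j)
    _ = 2 * Lk * M * D * (((N + 1 : ℕ) : ℝ)⁻¹ * ((N + 1 : ℕ) : ℝ)⁻¹ *
          ∑ i, ∑ j, |sphereMark Th (ζ i).2 (ζ j).2|) := by
        simp only [← Finset.mul_sum]
        ring
    _ ≤ 2 * Lk * M * D * (sphereMeasure.real (univ : Set (Metric.sphere (0 : V3) 1)) * C *
          (1 + 2 * configEnergy ζ / ((N + 1 : ℕ) : ℝ))) :=
        mul_le_mul_of_nonneg_left (sum_sum_abs_sphereMark_le_of_abs_le hC ζ) (by positivity)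
    _ = _ := by ring

/-- The pair functional of a continuous mark is continuous in the configuration (a finite double sum of
continuous functions). [folklore] -/
theorem continuous_pairFunctional_config {N : ℕ} {Th : V3 × V3 × V3 → ℝ} (hTh : Continuous Th) (r : ℝ)
    (x : UnitAddTorus (Fin 3)) :
    Continuous fun ζ : Config (N + 1) (Fin 3) T3 => pairFunctional r Th ζ x := by
  simp_rw [pairFunctional_eq_double_sum]
  refine continuous_const.mul (continuous_finsetSum _ fun i _ => continuous_finsetSum _ fun j _ => ?_)
  have hk : ∀ k : Fin (N + 1), Continuous fun ζ : Config (N + 1) (Fin 3) T3 => coneKernel r (ζ k).1 x := by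
    intro k
    unfold coneKernel
    have h1 : Continuous fun ζ : Config (N + 1) (Fin 3) T3 => Torus.euclidDist (ζ k).1 x := by
      have h2 : Continuous fun ζ : Config (N + 1) (Fin 3) T3 => ((ζ k).1, x) := by fun_prop
      simpa only [Function.comp_def] using Torus.continuous_euclidDist.comp h2
    fun_prop
  have hs : Continuous fun ζ : Config (N + 1) (Fin 3) T3 => sphereMark Th (ζ i).2 (ζ j).2 := by
    have h2 : Continuous fun ζ : Config (N + 1) (Fin 3) T3 => ((ζ i).2, (ζ j).2) := by fun_prop
    simpa only [Function.comp_def] using (continuous_sphereMark_uncurry hTh).comp h2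
  exact ((hk i).mul (hk j)).mul hs

/-! ### The time tent -/

/-- The time tent `r⁻¹ (1 − |u|/r)₊` lies in `[0, r⁻¹]` (`0 < r`). [folklore] -/
theorem timeTent_mem_Icc {r : ℝ} (hr : 0 < r) (u : ℝ) : r⁻¹ * max (1 - |u| / r) 0 ∈ Icc (0 : ℝ) r⁻¹ := by
  refine ⟨mul_nonneg (inv_nonneg.2 hr.le) (le_max_right _ _), ?_⟩
  have h1 : max (1 - |u| / r) 0 ≤ 1 := max_le (by linarith [div_nonneg (abs_nonneg u) hr.le]) zero_le_one
  exact (mul_le_mul_of_nonneg_left h1 (inv_nonneg.2 hr.le)).trans (mul_one _).le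

/-- The time tent is `r⁻²`-Lipschitz: `|r⁻¹(1 − |u|/r)₊ − r⁻¹(1 − |u'|/r)₊| ≤ r⁻¹ r⁻¹ |u − u'|`. [folklore] -/
theorem abs_timeTent_sub_le {r : ℝ} (hr : 0 < r) (u u' : ℝ) :
    |r⁻¹ * max (1 - |u| / r) 0 - r⁻¹ * max (1 - |u'| / r) 0| ≤ r⁻¹ * r⁻¹ * |u - u'| := by
  rw [← mul_sub, abs_mul, abs_of_pos (inv_pos.2 hr), mul_assoc]
  refine mul_le_mul_of_nonneg_left ?_ (inv_nonneg.2 hr.le)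
  have h1 : |max (1 - |u| / r) 0 - max (1 - |u'| / r) 0| ≤ |(1 - |u| / r) - (1 - |u'| / r)| :=
    abs_max_sub_max_le_abs _ _ _
  refine h1.trans ?_
  rw [show (1 - |u| / r) - (1 - |u'| / r) = r⁻¹ * (|u'| - |u|) by ring, abs_mul, abs_of_pos (inv_pos.2 hr)]
  refine mul_le_mul_of_nonneg_left ?_ (inv_nonneg.2 hr.le)
  rw [abs_sub_comm u u']
  exact abs_abs_sub_abs_le_abs_sub _ _

/-- The time tent is continuous. [folklore] -/
theorem continuous_timeTent (r s : ℝ) : Continuous fun s₀ : ℝ => r⁻¹ * max (1 - |s - s₀| / r) 0 := by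
  fun_prop

/-! ### The time-mollified pool pair field along a hard-sphere flow -/

/-- **The time-mollified pool pair field** of the orbit of `z` under the hard-sphere flow `Φ`:
`Pm(Th)(z, (s₀, x₀)) = ∫_{s ∈ [0,τ]} r⁻¹(1 − |s − s₀|/r)₊ · B_r(Th)(Φ_s z, x₀) ds` — VERBATIM the weight
`Pm (Θ Th) z s₀ x₀` of the route target `ContactChaos` (tent `bt`, bump `bx = coneKernel r`, `Θ = sphereMark`,
the inner double integral being `pairFunctional r Th (Φ_s z) x₀` by `rfl`). [folklore] -/
def poolPairField {σ : ℝ} {N : ℕ} (Φ : HardSphereFlow (Torus.geometry (Fin 3)) (hsDiameter σ N) (N + 1))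
    (Th : V3 × V3 × V3 → ℝ) (τ r : ℝ) (z : Config (N + 1) (Fin 3) T3) (p : ℝ × UnitAddTorus (Fin 3)) : ℝ :=
  ∫ s in Icc (0 : ℝ) τ, r⁻¹ * max (1 - |s - p.1| / r) 0 * pairFunctional r Th (Φ.flow s z) p.2

section Orbit

variable {σ : ℝ} {N : ℕ} {Φ : HardSphereFlow (Torus.geometry (Fin 3)) (hsDiameter σ N) (N + 1)}
  {z : Config (N + 1) (Fin 3) T3} {Th : V3 × V3 × V3 → ℝ} {C τ r E₀ : ℝ}

/-- Along a good orbit the pair functional at the anchor `x` is a measurable function of time. [folklore] -/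
theorem measurable_pairFunctional_orbit (hz : z ∈ Φ.good) (hTh : Continuous Th) (r : ℝ) (x : UnitAddTorus (Fin 3)) :
    Measurable fun s => pairFunctional r Th (Φ.flow s z) x := by
  have h := (continuous_pairFunctional_config (N := N) hTh r x).measurable.comp (measurable_orbit hz)
  simpa only [Function.comp_def, orbit_apply] using h

/-- Along a good orbit with kinetic energy per particle `≤ E₀` the pair functional of a bounded mark is
bounded by `P₀ = (3/πr³)² |S²| C (1 + 2E₀)` at all times (energy conservation). [folklore] -/
theorem abs_pairFunctional_orbit_le (hz : z ∈ Φ.good) (hC : ∀ p, |Th p| ≤ C) (hr : 0 < r)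
    (hE : ((N + 1 : ℕ) : ℝ)⁻¹ * configEnergy z ≤ E₀) (s : ℝ) (x : UnitAddTorus (Fin 3)) :
    |pairFunctional r Th (Φ.flow s z) x| ≤ (3 / (Real.pi * r ^ 3)) ^ 2 *
      (sphereMeasure.real (univ : Set (Metric.sphere (0 : V3) 1)) * C) * (1 + 2 * E₀) := by
  have h := abs_pairFunctional_le_of_abs_le hC hr (Φ.flow s z) x
  rw [Φ.configEnergy_flow hz s] at h
  refine h.trans (mul_le_mul_of_nonneg_left ?_ (by
    have hC0 : 0 ≤ C := (abs_nonneg _).trans (hC (0, 0, 0))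
    have : 0 ≤ sphereMeasure.real (univ : Set (Metric.sphere (0 : V3) 1)) := measureReal_nonneg
    positivity))
  have : 2 * configEnergy z / ((N + 1 : ℕ) : ℝ) = 2 * (((N + 1 : ℕ) : ℝ)⁻¹ * configEnergy z) := by
    rw [mul_div_assoc, div_eq_inv_mul]
  rw [this]
  linarith

/-- Along a good orbit with kinetic energy per particle `≤ E₀` the pair functional of a bounded mark is
`L₀ d(x, x')`-Lipschitz in the anchor at all times, `L₀ = 2(3/πr⁴)(3/πr³)|S²| C (1 + 2E₀)`. [folklore] -/
theorem abs_pairFunctional_orbit_sub_le (hz : z ∈ Φ.good) (hC : ∀ p, |Th p| ≤ C) (hr : 0 < r)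
    (hE : ((N + 1 : ℕ) : ℝ)⁻¹ * configEnergy z ≤ E₀) (s : ℝ) (x x' : UnitAddTorus (Fin 3)) :
    |pairFunctional r Th (Φ.flow s z) x - pairFunctional r Th (Φ.flow s z) x'| ≤
      2 * (3 / (Real.pi * r ^ 4)) * (3 / (Real.pi * r ^ 3)) *
        (sphereMeasure.real (univ : Set (Metric.sphere (0 : V3) 1)) * C * (1 + 2 * E₀)) *
          Torus.euclidDist x x' := by
  have h := abs_pairFunctional_sub_le_of_abs_le hC hr (Φ.flow s z) x x'
  rw [Φ.configEnergy_flow hz s] at h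
  have hC0 : 0 ≤ C := (abs_nonneg _).trans (hC (0, 0, 0))
  have hS0 : 0 ≤ sphereMeasure.real (univ : Set (Metric.sphere (0 : V3) 1)) := measureReal_nonneg
  have hD0 : 0 ≤ Torus.euclidDist x x' := by rw [Torus.euclidDist_eq]; exact norm_nonneg _
  refine h.trans (mul_le_mul_of_nonneg_right (mul_le_mul_of_nonneg_left ?_ (by positivity)) hD0)
  have : 2 * configEnergy z / ((N + 1 : ℕ) : ℝ) = 2 * (((N + 1 : ℕ) : ℝ)⁻¹ * configEnergy z) := by
    rw [mul_div_assoc, div_eq_inv_mul]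
  rw [this]
  exact mul_le_mul_of_nonneg_left (by linarith) (by positivity)

/-- The integrand of the time-mollified field is integrable on `[0, τ]` along a good orbit with bounded
kinetic energy per particle. [folklore] -/
theorem integrableOn_timeTent_mul_pairFunctional (hz : z ∈ Φ.good) (hTh : Continuous Th)
    (hC : ∀ p, |Th p| ≤ C) (hr : 0 < r) (hE : ((N + 1 : ℕ) : ℝ)⁻¹ * configEnergy z ≤ E₀) (s₀ : ℝ)
    (x : UnitAddTorus (Fin 3)) :
    IntegrableOn (fun s => r⁻¹ * max (1 - |s - s₀| / r) 0 * pairFunctional r Th (Φ.flow s z) x) (Icc 0 τ) := by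
  have hm : Measurable fun s => r⁻¹ * max (1 - |s - s₀| / r) 0 * pairFunctional r Th (Φ.flow s z) x :=
    ((continuous_const.mul ((continuous_const.sub ((continuous_id.sub continuous_const).abs.div_const _)).max
      continuous_const)).measurable).mul (measurable_pairFunctional_orbit hz hTh r x)
  refine IntegrableOn.of_bound measure_Icc_lt_top hm.aestronglyMeasurable
    (r⁻¹ * ((3 / (Real.pi * r ^ 3)) ^ 2 * (sphereMeasure.real (univ : Set (Metric.sphere (0 : V3) 1)) * C) *
      (1 + 2 * E₀))) ?_
  refine ae_of_all _ fun s => ?_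
  rw [Real.norm_eq_abs, abs_mul, abs_of_nonneg (timeTent_mem_Icc hr _).1]
  exact mul_le_mul (timeTent_mem_Icc hr _).2 (abs_pairFunctional_orbit_le hz hC hr hE s x) (abs_nonneg _)
    (inv_nonneg.2 hr.le)

/-- **Sup bound of the time-mollified pool pair field** along a good orbit with kinetic energy per particle
`≤ E₀`: `|Pm| ≤ τ r⁻¹ P₀` (`0 ≤ τ`). [folklore] -/
theorem abs_poolPairField_le (hz : z ∈ Φ.good) (hC : ∀ p, |Th p| ≤ C) (hr : 0 < r)
    (hτ : 0 ≤ τ) (hE : ((N + 1 : ℕ) : ℝ)⁻¹ * configEnergy z ≤ E₀) (p : ℝ × UnitAddTorus (Fin 3)) :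
    |poolPairField Φ Th τ r z p| ≤ τ * (r⁻¹ * ((3 / (Real.pi * r ^ 3)) ^ 2 *
      (sphereMeasure.real (univ : Set (Metric.sphere (0 : V3) 1)) * C) * (1 + 2 * E₀))) := by
  unfold poolPairField
  have h := norm_setIntegral_le_of_norm_le_const (μ := volume) (s := Icc (0 : ℝ) τ) measure_Icc_lt_top
    (f := fun s => r⁻¹ * max (1 - |s - p.1| / r) 0 * pairFunctional r Th (Φ.flow s z) p.2)
    (C := r⁻¹ * ((3 / (Real.pi * r ^ 3)) ^ 2 * (sphereMeasure.real (univ : Set (Metric.sphere (0 : V3) 1)) * C) *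
      (1 + 2 * E₀))) (fun s _ => ?_)
  · rw [Real.norm_eq_abs, Real.volume_real_Icc_of_le hτ, sub_zero, mul_comm] at h
    exact h
  · rw [Real.norm_eq_abs, abs_mul, abs_of_nonneg (timeTent_mem_Icc hr _).1]
    exact mul_le_mul (timeTent_mem_Icc hr _).2 (abs_pairFunctional_orbit_le hz hC hr hE s p.2) (abs_nonneg _)
      (inv_nonneg.2 hr.le)

/-- **The time-mollified pool pair field is jointly Lipschitz** along a good orbit with kinetic energy per
particle `≤ E₀`: `|Pm(p) − Pm(q)| ≤ τ (r⁻² P₀ |p.1 − q.1| + r⁻¹ L₀ d(p.2, q.2))` (`0 ≤ τ`). [folklore] -/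
theorem abs_poolPairField_sub_le (hz : z ∈ Φ.good) (hTh : Continuous Th) (hC : ∀ p, |Th p| ≤ C) (hr : 0 < r)
    (hτ : 0 ≤ τ) (hE : ((N + 1 : ℕ) : ℝ)⁻¹ * configEnergy z ≤ E₀) (p q : ℝ × UnitAddTorus (Fin 3)) :
    |poolPairField Φ Th τ r z p - poolPairField Φ Th τ r z q| ≤
      τ * (r⁻¹ * r⁻¹ * ((3 / (Real.pi * r ^ 3)) ^ 2 *
          (sphereMeasure.real (univ : Set (Metric.sphere (0 : V3) 1)) * C) * (1 + 2 * E₀)) * |p.1 - q.1| +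
        r⁻¹ * (2 * (3 / (Real.pi * r ^ 4)) * (3 / (Real.pi * r ^ 3)) *
          (sphereMeasure.real (univ : Set (Metric.sphere (0 : V3) 1)) * C * (1 + 2 * E₀))) *
            Torus.euclidDist p.2 q.2) := by
  set P₀ := (3 / (Real.pi * r ^ 3)) ^ 2 * (sphereMeasure.real (univ : Set (Metric.sphere (0 : V3) 1)) * C) *
    (1 + 2 * E₀) with hP₀
  set L₀ := 2 * (3 / (Real.pi * r ^ 4)) * (3 / (Real.pi * r ^ 3)) *
    (sphereMeasure.real (univ : Set (Metric.sphere (0 : V3) 1)) * C * (1 + 2 * E₀)) with hL₀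
  have hIp := integrableOn_timeTent_mul_pairFunctional (τ := τ) hz hTh hC hr hE p.1 p.2
  have hIq := integrableOn_timeTent_mul_pairFunctional (τ := τ) hz hTh hC hr hE q.1 q.2
  unfold poolPairField
  rw [← integral_sub hIp hIq]
  have h := norm_setIntegral_le_of_norm_le_const (μ := volume) (s := Icc (0 : ℝ) τ) measure_Icc_lt_top
    (f := fun s => r⁻¹ * max (1 - |s - p.1| / r) 0 * pairFunctional r Th (Φ.flow s z) p.2 -
      r⁻¹ * max (1 - |s - q.1| / r) 0 * pairFunctional r Th (Φ.flow s z) q.2)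
    (C := r⁻¹ * r⁻¹ * P₀ * |p.1 - q.1| + r⁻¹ * L₀ * Torus.euclidDist p.2 q.2) (fun s _ => ?_)
  · rw [Real.norm_eq_abs, Real.volume_real_Icc_of_le hτ, sub_zero, mul_comm] at h
    exact h
  · rw [Real.norm_eq_abs]
    set a := r⁻¹ * max (1 - |s - p.1| / r) 0 with ha
    set a' := r⁻¹ * max (1 - |s - q.1| / r) 0 with ha'
    set F := pairFunctional r Th (Φ.flow s z) p.2 with hF
    set F' := pairFunctional r Th (Φ.flow s z) q.2 with hF'
    have hsplit : a * F - a' * F' = (a - a') * F + a' * (F - F') := by ring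
    rw [hsplit]
    have h1 : |a - a'| ≤ r⁻¹ * r⁻¹ * |p.1 - q.1| := by
      have h := abs_timeTent_sub_le hr (s - p.1) (s - q.1)
      rw [show s - p.1 - (s - q.1) = -(p.1 - q.1) by ring, abs_neg] at h
      exact h
    have h2 : |F| ≤ P₀ := abs_pairFunctional_orbit_le hz hC hr hE s p.2
    have h3 : |F - F'| ≤ L₀ * Torus.euclidDist p.2 q.2 := abs_pairFunctional_orbit_sub_le hz hC hr hE s p.2 q.2
    have ha'0 : 0 ≤ a' := (timeTent_mem_Icc hr _).1
    have ha'1 : a' ≤ r⁻¹ := (timeTent_mem_Icc hr _).2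
    calc |(a - a') * F + a' * (F - F')| ≤ |a - a'| * |F| + a' * |F - F'| := by
          refine (abs_add_le _ _).trans (le_of_eq ?_)
          rw [abs_mul, abs_mul, abs_of_nonneg ha'0]
      _ ≤ r⁻¹ * r⁻¹ * |p.1 - q.1| * P₀ + r⁻¹ * (L₀ * Torus.euclidDist p.2 q.2) :=
          add_le_add (mul_le_mul h1 h2 (abs_nonneg _) (by positivity))
            (mul_le_mul ha'1 h3 (abs_nonneg _) (inv_nonneg.2 hr.le))
      _ = _ := by ring

/-- **The time-mollified pool pair field of a good orbit is continuous** in `(s₀, x₀)` (jointly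
Lipschitz, the sup-distance of the torus dominating... being dominated by the minimal-image distance up to
`√3`). [folklore] -/
theorem continuous_poolPairField (hz : z ∈ Φ.good) (hTh : Continuous Th) (hC : ∀ p, |Th p| ≤ C) (hr : 0 < r)
    (hτ : 0 ≤ τ) : Continuous (poolPairField Φ Th τ r z) := by
  have hE : ((N + 1 : ℕ) : ℝ)⁻¹ * configEnergy z ≤ ((N + 1 : ℕ) : ℝ)⁻¹ * configEnergy z := le_rfl
  set P₀ := (3 / (Real.pi * r ^ 3)) ^ 2 * (sphereMeasure.real (univ : Set (Metric.sphere (0 : V3) 1)) * C) *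
    (1 + 2 * (((N + 1 : ℕ) : ℝ)⁻¹ * configEnergy z)) with hP₀
  set L₀ := 2 * (3 / (Real.pi * r ^ 4)) * (3 / (Real.pi * r ^ 3)) *
    (sphereMeasure.real (univ : Set (Metric.sphere (0 : V3) 1)) * C * (1 + 2 * (((N + 1 : ℕ) : ℝ)⁻¹ * configEnergy z)))
    with hL₀
  have hC0 : 0 ≤ C := (abs_nonneg _).trans (hC (0, 0, 0))
  have hS0 : 0 ≤ sphereMeasure.real (univ : Set (Metric.sphere (0 : V3) 1)) := measureReal_nonneg
  have hEz : 0 ≤ ((N + 1 : ℕ) : ℝ)⁻¹ * configEnergy z := by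
    unfold configEnergy; positivity
  have hP₀0 : 0 ≤ P₀ := by positivity
  have hL₀0 : 0 ≤ L₀ := by positivity
  set K : ℝ := τ * (r⁻¹ * r⁻¹ * P₀ + r⁻¹ * L₀ * Real.sqrt 3) with hK
  have hK0 : 0 ≤ K := by positivity
  refine continuous_iff_continuousAt.2 fun p => ?_
  refine Metric.continuousAt_iff.2 fun ε hε => ⟨ε / (K + 1), by positivity, fun q hq => ?_⟩
  rw [Real.dist_eq]
  have hmain := abs_poolPairField_sub_le hz hTh hC hr hτ hE q p
  have hd1 : |q.1 - p.1| ≤ dist q p := by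
    rw [← Real.dist_eq, Prod.dist_eq]; exact le_max_left _ _
  have hd2 : Torus.euclidDist q.2 p.2 ≤ Real.sqrt 3 * dist q p := by
    have h := Torus.euclidDist_le_holds (d := Fin 3) q.2 p.2
    simp only [Fintype.card_fin, Nat.cast_ofNat] at h
    refine h.trans (mul_le_mul_of_nonneg_left ?_ (Real.sqrt_nonneg _))
    rw [← dist_eq_norm, Prod.dist_eq]
    exact le_max_right _ _
  calc |poolPairField Φ Th τ r z q - poolPairField Φ Th τ r z p|
      ≤ τ * (r⁻¹ * r⁻¹ * P₀ * |q.1 - p.1| + r⁻¹ * L₀ * Torus.euclidDist q.2 p.2) := hmain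
    _ ≤ τ * (r⁻¹ * r⁻¹ * P₀ * dist q p + r⁻¹ * L₀ * (Real.sqrt 3 * dist q p)) := by gcongr
    _ = K * dist q p := by rw [hK]; ring
    _ ≤ K * (ε / (K + 1)) := mul_le_mul_of_nonneg_left hq.le hK0
    _ < ε := by
        rw [mul_div_assoc']
        rw [div_lt_iff₀ (by positivity)]
        nlinarith

end Orbit

end Literature.MathematicalPhysics.KineticTheory

end
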